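import Mathlib
import Summits.Schanuel.Schanuel.Theses.RigidCore
import Summits.Schanuel.Schanuel.Theorems.RigidCoreMinimalCounterexampleInAclLogSector
import Summits.Schanuel.Schanuel.Theorems.MinimalCounterexampleInAcl.Negative.IsolationFree

/-!
# Selection is slice finiteness — crux stmt-Schanuel-0969 `RigidCore.MinimalCounterexampleInAcl` (S*)

Line `kernel-arithmetic-selection` (lead prover-line-stmt-Schanuel-0969-c9-0), `--supports stmt-Schanuel-0969`, registered stub
`stub_expAcl_iff_finiteDefinableSlice`.

For a ℚ-linearly independent tuple `x : Fin n → ℂ` (any rank), the CONCLUSION of (S*) at `x` — every coordinate `x i` lies in a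
finite `∅`-definable subset of `ℂ_exp` — holds IF AND ONLY IF some `∅`-definable subset of the mate class `locusMates x` containing
`x` is finite (`expAcl_iff_finite_definable_slice`).  `←` is the landed `isolationFree` localised to the slice (coordinate
projections of a finite `∅`-definable set of tuples are finite and `∅`-definable); `→` takes the slice
`locusMates x ∩ ⋂ᵢ {y | y i ∈ sᵢ}` for finite `∅`-definable `sᵢ ∋ x i` (`locusMates x` is one `∅`-formula because `ℤ`, hence
ℚ-linear independence, is `∅`-definable, [KirbyMacintyreOnshuus2012, §2]).  Consequence for the two open residues of the line
(`stub_pureTwistedResidue`, `stub_geThree` = item stmt-Schanuel-14744): every proof of them is a FINITENESS theorem for a definable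
slice of the mate class; the three landed levers (mate finiteness, torsor/window selection, gadget selection) are instances.

References: [KirbyMacintyreOnshuus2012] J. Kirby, A. Macintyre, A. Onshuus, *The algebraic numbers definable in various
exponential fields*, J. Inst. Math. Jussieu 11 (2012), arXiv:1101.4224, §2; [Marker2002] D. Marker, *Model Theory: An
Introduction*, GTM 217, §1.3 (`acl`, definable sets are closed under projection).
-/

noncomputable section

set_option linter.dupNamespace false

open Complex Set FirstOrder

namespace Summit.Schanuel.Schanuel.Cruxes.MinimalCounterexampleInAcl.KernelArithmeticSelection

open Literature.ModelTheory.ExponentialFields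
open Summit.Schanuel.Schanuel.Theorems.AclSubsetLogFreeCore.Negative
open Summit.Schanuel.Schanuel.Theorems.MinimalCounterexampleInAcl.Negative (definable₁_image_eval)

variable {n : ℕ}

/-- A coordinate condition `y i ∈ s` with `s` a `∅`-definable subset of `ℂ` is `∅`-definable on tuples. [cite: Marker2002, §1.3] -/
theorem definable_coord_mem {s : Set ℂ} (hs : Set.Definable₁ (∅ : Set ℂ) Language.expRing s) (i : Fin n) :
    (∅ : Set ℂ).Definable Language.expRing {y : Fin n → ℂ | y i ∈ s} := by
  have e : {y : Fin n → ℂ | y i ∈ s} =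
      (fun g : Fin n → ℂ => g ∘ fun _ : Fin 1 => i) ⁻¹' {v : Fin 1 → ℂ | v 0 ∈ s} := by
    ext y; simp
  rw [e]
  exact hs.preimage_comp _

/-- **Selection is slice finiteness.**  For ℚ-linearly independent `x`, every coordinate of `x` is in `acl(∅)` iff some
`∅`-definable subset of `locusMates x` containing `x` is finite. [cite: KirbyMacintyreOnshuus2012, §2] -/
theorem expAcl_iff_finite_definable_slice {x : Fin n → ℂ} (hx : LinearIndependent ℚ x) :
    (∀ i, x i ∈ expAcl) ↔
      ∃ S : Set (Fin n → ℂ), S ⊆ locusMates x ∧ x ∈ S ∧ S.Finite ∧ (∅ : Set ℂ).Definable Language.expRing S := by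
  constructor
  · intro h
    choose s hsfin hsdef hxs using h
    refine ⟨locusMates x ∩ ⋂ i, {y : Fin n → ℂ | y i ∈ s i}, Set.inter_subset_left, ?_, ?_, ?_⟩
    · exact ⟨self_mem_locusMates x hx, Set.mem_iInter.2 fun i => hxs i⟩
    · refine (Set.Finite.pi (t := s) fun i => hsfin i).subset ?_
      intro y hy
      exact Set.mem_univ_pi.2 fun i => Set.mem_iInter.1 hy.2 i
    · exact (locusMates_definable x).inter (Set.definable_iInter_of_finite fun i => definable_coord_mem (hsdef i) i)
  · rintro ⟨S, -, hxS, hSfin, hSdef⟩ i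
    exact ⟨(fun y : Fin n → ℂ => y i) '' S, hSfin.image _, definable₁_image_eval hSdef i, ⟨x, hxS, rfl⟩⟩

/-- The useful direction in isolation: a finite `∅`-definable set of tuples puts every coordinate of each of its members in
`acl(∅)` (no linear independence, no mate class needed). [cite: Marker2002, §1.3] -/
theorem mem_expAcl_of_mem_finite_definable {S : Set (Fin n → ℂ)} (hSfin : S.Finite)
    (hSdef : (∅ : Set ℂ).Definable Language.expRing S) {x : Fin n → ℂ} (hxS : x ∈ S) (i : Fin n) : x i ∈ expAcl :=
  ⟨(fun y : Fin n → ℂ => y i) '' S, hSfin.image _, definable₁_image_eval hSdef i, ⟨x, hxS, rfl⟩⟩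

/-- For a first failure the slice criterion reads: (S*) at `x` iff a finite `∅`-definable slice of its mate class contains `x`;
in particular (S*) at `x` follows from finiteness of `locusMates x` itself (the slice = the class; `isolationFree`).
[cite: KirbyMacintyreOnshuus2012, §2] -/
theorem firstFailure_expAcl_iff_slice {x : Fin n → ℂ} (hx : x ∈ firstFailures n) :
    (∀ i, x i ∈ expAcl) ↔
      ∃ S : Set (Fin n → ℂ), S ⊆ locusMates x ∧ x ∈ S ∧ S.Finite ∧ (∅ : Set ℂ).Definable Language.expRing S :=
  expAcl_iff_finite_definable_slice hx.1

/-! ## Registered form -/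

/-- Registered form (stub `stub_expAcl_iff_finiteDefinableSlice` of crux stmt-Schanuel-0969, line kernel-arithmetic-selection, lead c9):
selection is slice finiteness, every rank. [cite: KirbyMacintyreOnshuus2012, §2] -/
theorem stub_expAcl_iff_finiteDefinableSlice : ∀ (n : ℕ) (x : Fin n → ℂ), LinearIndependent ℚ x → ((∀ i, x i ∈ Summit.Schanuel.Schanuel.Theorems.AclSubsetLogFreeCore.Negative.expAcl) ↔ ∃ S : Set (Fin n → ℂ), S ⊆ Summit.Schanuel.Schanuel.Cruxes.MinimalCounterexampleInAcl.KernelArithmeticSelection.locusMates x ∧ x ∈ S ∧ S.Finite ∧ (∅ : Set ℂ).Definable Literature.ModelTheory.ExponentialFields.Language.expRing S) :=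
  fun _ _ hx => expAcl_iff_finite_definable_slice hx

end Summit.Schanuel.Schanuel.Cruxes.MinimalCounterexampleInAcl.KernelArithmeticSelection

end
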